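import Mathlib

/-!
# Ordered escape ladders lift to SDPP families of constant-weight word products (support file)

Item `stmt-MatrixMultiplication-14308` (`FourierTwoFamiliesModP.PrimeTwoFamilies`, CKSU 2005
Conj. 4.7 with prime cyclic hosts), line Sketch, stub `stub_lift`.

An ORDERED ESCAPE LADDER in an abelian group `K` is a family of `r` classes `(X c, Y c)` with

* (hW) every class direct: `(x - x') + (y - y') = 0 ⟹ x = x' ∧ y = y'` inside one class;
* (hL) for classes `p < q`, every lower cross difference `y' - x'` (`x' ∈ X p`, `y' ∈ Y q`) differs
  from every diagonal difference `y - x` (`x ∈ X c`, `y ∈ Y c`).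

THE LIFT (`stub_lift`, CKSU arXiv:math/0511460 Lemma 21 / Prop. 24, one-directional version): for
words `w : Fin L → Fin r` of a fixed digit sum `S`, the product sets `A w = ∏ₜ X (w t)`,
`B w = ∏ₜ Y (w t)` in `Fin L → K` satisfy the two clauses of the simultaneous double product
property: (W) each pair `(A w, B w)` is direct, and (X) `(a - a') + (b - b') = 0` with `a ∈ A i`,
`a' ∈ A j`, `b ∈ B j`, `b' ∈ B k` forces `i = k`.  The point of (X): two distinct words of equal
digit sum differ upwards in some coordinate `t` (`i t < k t`), and there the ladder clause (hL)
separates the coordinate equation `b t - a' t = b' t - a t`.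
-/

-- single-conjunct summit: the mandated namespace repeats `MatrixMultiplication` (summit = sub-problem).
set_option linter.dupNamespace false

namespace Summit.MatrixMultiplication.MatrixMultiplication.Theorems.PrimeTwoFamilies.LadderLift

open Finset

/-- Two words `i k : Fin L → Fin r` of equal digit sum with `i ≠ k` differ upwards somewhere:
there is a coordinate `t` with `i t < k t`. -/
private lemma exists_lt_of_sum_eq_of_ne {L r : ℕ} {i k : Fin L → Fin r}
    (hsum : ∑ t, ((i t : ℕ)) = ∑ t, ((k t : ℕ))) (hik : i ≠ k) : ∃ t, i t < k t := by
  by_contra hex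
  have hle : ∀ t ∈ (Finset.univ : Finset (Fin L)), ((k t : ℕ)) ≤ ((i t : ℕ)) :=
    fun t _ => Fin.le_def.1 (not_lt.1 fun h => hex ⟨t, h⟩)
  have heq := (Finset.sum_eq_sum_iff_of_le hle).1 hsum.symm
  exact hik (funext fun t => Fin.ext ((heq t (Finset.mem_univ t)).symm))

/-- THE LIFT (CKSU Lemma 21 / Prop. 24, one-directional): an ordered escape ladder `(X c, Y c)_{c<r}`
in an abelian group `K` gives, for every length `L` and digit sum `S`, an SDPP family in `Fin L → K`
indexed by the words `w : Fin L → Fin r` of digit sum `S`, with `A w = ∏ₜ X (w t)`,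
`B w = ∏ₜ Y (w t)`: clause (W) (first conjunct) and clause (X) (second conjunct). -/
theorem stub_lift {K : Type*} [AddCommGroup K] [DecidableEq K] {r : ℕ} (X Y : Fin r → Finset K)
    (hW : ∀ c : Fin r, ∀ x ∈ X c, ∀ x' ∈ X c, ∀ y ∈ Y c, ∀ y' ∈ Y c,
      (x - x') + (y - y') = 0 → x = x' ∧ y = y')
    (hL : ∀ c p q : Fin r, p < q → ∀ x ∈ X c, ∀ y ∈ Y c, ∀ x' ∈ X p, ∀ y' ∈ Y q, y - x ≠ y' - x')
    (L S : ℕ) :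
    (∀ w : Fin L → Fin r, ∑ t, ((w t : ℕ)) = S →
      ∀ a ∈ Fintype.piFinset (fun t => X (w t)), ∀ a' ∈ Fintype.piFinset (fun t => X (w t)),
      ∀ b ∈ Fintype.piFinset (fun t => Y (w t)), ∀ b' ∈ Fintype.piFinset (fun t => Y (w t)),
        (a - a') + (b - b') = 0 → a = a' ∧ b = b') ∧
    (∀ i j k : Fin L → Fin r, ∑ t, ((i t : ℕ)) = S → ∑ t, ((j t : ℕ)) = S → ∑ t, ((k t : ℕ)) = S →
      ∀ a ∈ Fintype.piFinset (fun t => X (i t)), ∀ a' ∈ Fintype.piFinset (fun t => X (j t)),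
      ∀ b ∈ Fintype.piFinset (fun t => Y (j t)), ∀ b' ∈ Fintype.piFinset (fun t => Y (k t)),
        (a - a') + (b - b') = 0 → i = k) := by
  refine ⟨?_, ?_⟩
  · -- (W): coordinatewise directness
    intro w _ a ha a' ha' b hb b' hb' h
    rw [Fintype.mem_piFinset] at ha ha' hb hb'
    have key : ∀ t, a t = a' t ∧ b t = b' t := fun t =>
      hW (w t) (a t) (ha t) (a' t) (ha' t) (b t) (hb t) (b' t) (hb' t)
        (by have := congrFun h t; simpa using this)
    exact ⟨funext fun t => (key t).1, funext fun t => (key t).2⟩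
  · -- (X): distinct words of equal digit sum differ upwards somewhere; the ladder separates there
    intro i j k hi _ hk a ha a' ha' b hb b' hb' h
    rw [Fintype.mem_piFinset] at ha ha' hb hb'
    by_contra hik
    have key : ∀ t, (a t - a' t) + (b t - b' t) = 0 := fun t => by
      have := congrFun h t; simpa using this
    obtain ⟨t, ht⟩ := exists_lt_of_sum_eq_of_ne (hi.trans hk.symm) hik
    refine hL (j t) (i t) (k t) ht (a' t) (ha' t) (b t) (hb t) (a t) (ha t) (b' t) (hb' t) ?_
    -- `b t - a' t = b' t - a t` from the `t`-th coordinate of `h`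
    rw [← sub_eq_zero, ← key t]
    abel

end Summit.MatrixMultiplication.MatrixMultiplication.Theorems.PrimeTwoFamilies.LadderLift
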